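import Literature.Computability.QuantumComplexity.CoreFamily
import Literature.Computability.QuantumComplexity.CoreBudget
import Literature.Computability.QuantumComplexity.CoinFamilyKernel
import HarnessLib

/-!
# The AJL core family solves its relation with probability `2/3`

Topic `Literature/Computability/QuantumComplexity`; a step in the discharge of
`ajl_jonesApproxProblem_mem_PromiseBQP` (AJL §3.3 with Claim 3.3 and Thm. 4.3: the Hadamard-test
counts are close to their means with probability `≥ 3/4`; here `≥ 5/6 − 1/6 = 2/3` including the
gate-approximation error). For the family of `CoreFamily.lean`: the letters `βOf` and the pattern
`patOf` read off a well-formed input (`WF`: `t ≥ 1`, at most one table bit per slot), the content of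
the blocks after the fan-out (`z1_block_*`), the amplitude `z₀ = Q(b)_{pp}`, the relation `Rcore`
("the test-qubit counts are good for `z₀` at scale `t`", everything if the input is not well
formed), and the bound `twoThirds_le_kernelProb`.

## References

* D. Aharonov, V. Jones, Z. Landau, Algorithmica 55 (2009), §3.3, Claim 3.3, Thm. 4.3
  [AharonovJonesLandau2009].
-/

noncomputable section

namespace Literature.Computability.QuantumComplexity

open _root_.Matrix Finset Cryptography RevSim BlockKit
open scoped Matrix.Norms.L2Operator

namespace AJLCore

variable (ℓ : ℕ)

/-! ### Reading the input -/

/-- The table bit of slot `s`, letter `p`. [folklore] -/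
def tabBit (h : Fits ℓ) (xin : QReg ℓ) (s : Fin (rOf ℓ)) (p : Fin (nOf ℓ - 1) × Bool) : Bool :=
  xin ⟨tabPos ℓ s p, by have := tabPos_lt ℓ s p; unfold Fits at h; omega⟩

/-- The pattern field. [folklore] -/
def patOf (h : Fits ℓ) (xin : QReg ℓ) : QReg (2 * (nOf ℓ + 1)) :=
  fun i => xin ⟨patPos ℓ i, by have := i.2; unfold Fits at h; unfold patPos; omega⟩

/-- **Well-formed inputs**: `t ≥ 1` and at most one table bit per slot. [folklore] -/
structure WF (xin : QReg ℓ) : Prop where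
  /-- the size parameter is positive -/
  pos : 1 ≤ tOf ℓ
  /-- each slot holds at most one letter -/
  slot : ∀ s p p', tabBit ℓ (fits_of_pos pos) xin s p = true → tabBit ℓ (fits_of_pos pos) xin s p' = true → p = p'

/-- The optional letter of slot `s`. [folklore] -/
def βOf (h : Fits ℓ) (xin : QReg ℓ) (s : Fin (rOf ℓ)) : Option (Fin (nOf ℓ - 1) × Bool) :=
  if hs : ∃ p, tabBit ℓ h xin s p = true then some hs.choose else none

variable {ℓ}

/-- On well-formed inputs the table bits are the one-hot encoding of the letters. [folklore] -/
theorem tabBit_eq_decide {xin : QReg ℓ} (hW : WF ℓ xin) (s : Fin (rOf ℓ)) (p : Fin (nOf ℓ - 1) × Bool) :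
    tabBit ℓ (fits_of_pos hW.pos) xin s p = decide (βOf ℓ (fits_of_pos hW.pos) xin s = some p) := by
  unfold βOf
  by_cases hs : ∃ p, tabBit ℓ (fits_of_pos hW.pos) xin s p = true
  · rw [dif_pos hs]
    have hc := hs.choose_spec
    by_cases hp : tabBit ℓ (fits_of_pos hW.pos) xin s p = true
    · rw [hp, hW.slot s _ _ hc hp]; simp
    · have hne : hs.choose ≠ p := fun h => hp (h ▸ hc)
      simp [hp, hne]
  · rw [dif_neg hs]
    have hp : tabBit ℓ (fits_of_pos hW.pos) xin s p = false := by
      by_contra h; exact hs ⟨p, by simpa using h⟩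
    rw [hp]; simp

/-! ### The blocks after the fan-out -/

variable (ℓ)

/-- The basis label after stage 1. [folklore] -/
def z1 (xin : QReg ℓ) : QReg (ℓ + anc ℓ) := revEval (fanoutOps (pairs ℓ) (pairs_ne ℓ)) (padInput xin (anc ℓ))

/-- Stage 1 maps the padded input to `z1`. [folklore] -/
theorem stage1_mulVec (xin : QReg ℓ) :
    (⟨stage1 ℓ⟩ : QCircuit cliffordT (ℓ + anc ℓ)).toMatrix 0 *ᵥ basisState (padInput xin (anc ℓ)) = basisState (z1 ℓ xin) :=
  fanout_mulVec_basisState _ _ _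

variable {ℓ}

/-- The test qubit of every block is off. [folklore] -/
theorem z1_block_q (xin : QReg ℓ) (j : Fin (mOf ℓ)) : z1 ℓ xin (Eblk ℓ j (Gb ℓ).q) = false :=
  fanout_other ℓ xin j _ (fun s p h => (Gb_ok ℓ).q_tw s p h.symm) (fun i h => (Gb_ok ℓ).q_E ⟨i, h⟩)

/-- The path register of every block holds the pattern. [folklore] -/
theorem z1_block_E (h : Fits ℓ) (xin : QReg ℓ) (j : Fin (mOf ℓ)) : (z1 ℓ xin ∘ Eblk ℓ j) ∘ (Gb ℓ).E = patOf ℓ h xin :=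
  funext fun i => fanout_E ℓ h xin j i

/-- Kit wires (Hadamard, region, helpers) are neither table nor path wires. [folklore] -/
theorem kit_wire_apart {a : Fin (bOf ℓ)} (ha : a ∈ (Gb ℓ).kit.cr :: (Gb ℓ).kit.as ++ (Gb ℓ).kit.region ∨ a ∈ (Gb ℓ).kit.hs) :
    (∀ s p, (Gb ℓ).tw s p ≠ a) ∧ ∀ i, (Gb ℓ).E i ≠ a := by
  obtain ⟨h1, h2, h3⟩ := @BlockGeom.sizes (nOf ℓ) (rOf ℓ) (kOf ℓ)
  -- the value of `a` is at least `dataOff + 1`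
  have hval : dataOff (nOf ℓ) (rOf ℓ) + 1 ≤ (a : ℕ) := by
    rcases ha with ha | ha
    · rw [List.cons_append, List.mem_cons, List.mem_append] at ha
      rcases ha with ha | ha | ha
      · exact (BlockGeom.had_val (n := nOf ℓ) (r := rOf ℓ) (k := kOf ℓ) (by rw [ha]; exact List.mem_cons_self ..)).1
      · exact (BlockGeom.had_val (n := nOf ℓ) (r := rOf ℓ) (k := kOf ℓ) (List.mem_cons_of_mem _ ha)).1
      · have := GadgetKit.region_val (Gb_ok ℓ).kit a ha
        change rb (nOf ℓ) (rOf ℓ) (kOf ℓ) ≤ (a : ℕ) at this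
        omega
    · have := (BlockGeom.hs_val (n := nOf ℓ) (r := rOf ℓ) (k := kOf ℓ) ha).1; omega
  refine ⟨fun s p h => ?_, fun i h => ?_⟩
  · have := BlockGeom.twNat_lt s.2 p (n := nOf ℓ) (r := rOf ℓ)
    have htw := BlockGeom.tw_val (n := nOf ℓ) (r := rOf ℓ) (k := kOf ℓ) s p
    change (((Gb ℓ).tw s p : Fin (bOf ℓ)) : ℕ) = _ at htw
    have hv := congrArg Fin.val h; omega
  · have hE := BlockGeom.E_val (n := nOf ℓ) (r := rOf ℓ) (k := kOf ℓ) i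
    change (((Gb ℓ).E i : Fin (bOf ℓ)) : ℕ) = _ at hE
    have hv := congrArg Fin.val h; have := i.2; omega

/-- **Every block is clean and table-consistent** after the fan-out of a well-formed input. [folklore] -/
theorem z1_block_Pcopy {xin : QReg ℓ} (hW : WF ℓ xin) (j : Fin (mOf ℓ)) :
    z1 ℓ xin ∘ Eblk ℓ j ∈ (Gb ℓ).Pcopy (βOf ℓ (fits_of_pos hW.pos) xin) := by
  refine ⟨⟨fun a ha => ?_, fun a ha => ?_⟩, fun s p => ?_⟩
  · obtain ⟨h1, h2⟩ := kit_wire_apart (Or.inl ha); exact fanout_other ℓ xin j a h1 h2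
  · obtain ⟨h1, h2⟩ := kit_wire_apart (Or.inr ha); exact fanout_other ℓ xin j a h1 h2
  · show z1 ℓ xin (Eblk ℓ j ((Gb ℓ).tw s p)) = _
    rw [z1, fanout_tw ℓ (fits_of_pos hW.pos), ← tabBit_eq_decide hW]; rfl

/-! ### The relation -/

variable (ℓ)

/-- The pattern read on the test qubits. [folklore] -/
def patternOf (z : QReg (ℓ + anc ℓ)) : Fin (mOf ℓ) → Bool := fun j => z (Eblk ℓ j (Gb ℓ).q)

/-- The amplitude estimated by the copies: `Q(b)_{pp}`. [cite: AharonovJonesLandau2009, §3.3] -/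
def z₀ (h : Fits ℓ) (xin : QReg ℓ) : ℂ :=
  ajlPosCoreMatrix (WordGeom.wordOf (βOf ℓ h xin)) (patOf ℓ h xin) (patOf ℓ h xin)

/-- `|z₀| ≤ 1`. [folklore] -/
theorem norm_z₀_le (h : Fits ℓ) (xin : QReg ℓ) : ‖z₀ ℓ h xin‖ ≤ 1 := norm_ajlPosCoreMatrix_apply_le_one _ _ _

/-- A pattern of the copies is good when the corresponding trial pattern is good for `z₀` at
scale `t`. [cite: AharonovJonesLandau2009, Claim 3.3] -/
def GoodPat (h : Fits ℓ) (xin : QReg ℓ) (γ : Fin (mOf ℓ) → Bool) : Prop :=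
  AJLSampler.Good (z₀ ℓ h xin) (tOf ℓ) (KOf ℓ) (γ ∘ (toTrial (KOf ℓ)).symm)

/-- Good patterns are decidable. [folklore] -/
instance (h : Fits ℓ) (xin : QReg ℓ) : DecidablePred (GoodPat ℓ h xin) := fun _ => by unfold GoodPat; infer_instance

/-- **The core relation**: on well-formed inputs, the output strings whose test-qubit counts are
good; everything otherwise. [cite: AharonovJonesLandau2009, §3.3 and Claim 3.3] -/
def Rcore (d : List Bool) : Set (List Bool) :=
  {y | ∀ hW : WF d.length d.get, GoodPat d.length (fits_of_pos hW.pos) d.get fun j => y.getD (Eblk d.length j (Gb d.length).q) false}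

/-! ### The bound -/

/-- Entries of `List.ofFn`. [folklore] -/
theorem getD_ofFn {W : ℕ} (z : QReg W) (w : Fin W) : (List.ofFn z).getD w false = z w := by
  rw [List.getD_eq_getElem?_getD, List.getElem?_ofFn]; simp

/-- The number of letters. [folklore] -/
theorem length_allLetters (n : ℕ) : (allLetters n).length = 2 * (n - 1) := by
  unfold allLetters
  rw [List.length_flatMap]; simp [List.sum_replicate]; omega

/-- The error of the copies is within the budget. [cite: AharonovJonesLandau2009, Thm. 4.3] -/
theorem copies_err_le : (mOf ℓ : ℝ) * WordGeom.wordErr (nOf ℓ) (rOf ℓ) (Gb ℓ).kit.k ≤ 1 / 6 := by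
  have hk : (Gb ℓ).kit.k = kOf ℓ := rfl
  rw [hk, WordGeom.wordErr, length_allLetters]
  unfold mOf KOf nOf rOf kOf
  push_cast
  have := budget (tOf ℓ)
  convert this using 2 <;> push_cast <;> ring

/-- The ideal statistics of the copies is the sampler's probability of the good event.
[cite: AharonovJonesLandau2009, §3.3] -/
theorem idealSum_eq_pr (h : Fits ℓ) (xin : QReg ℓ) :
    ∑ γ ∈ Finset.univ.filter (GoodPat ℓ h xin), ∏ j, idealWeight (z₀ ℓ h xin) (ty ℓ j) (γ j) =
      AJLSampler.pr (z₀ ℓ h xin) (AJLSampler.Good (z₀ ℓ h xin) (tOf ℓ) (KOf ℓ)) := by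
  rw [AJLSampler.pr, Finset.sum_filter]
  rw [← sum_patterns_eq (KOf ℓ) (fun γ' => if AJLSampler.Good (z₀ ℓ h xin) (tOf ℓ) (KOf ℓ) γ' then AJLSampler.weight (z₀ ℓ h xin) γ' else 0)]
  refine Finset.sum_congr rfl fun γ _ => ?_
  by_cases hg : AJLSampler.Good (z₀ ℓ h xin) (tOf ℓ) (KOf ℓ) (γ ∘ (toTrial (KOf ℓ)).symm)
  · rw [if_pos hg, if_pos (show GoodPat ℓ h xin γ from hg), AJLSampler.weight, ← prod_copies_eq_prod_trials (KOf ℓ)]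
    refine Finset.prod_congr rfl fun j _ => ?_
    rw [idealWeight_eq_testProb, ty, ← toTrial_fst, Function.comp_apply, Equiv.symm_apply_apply]
  · rw [if_neg hg, if_neg (show ¬ GoodPat ℓ h xin γ from hg)]

/-- **The core family is good on every input with probability at least `2/3`.**
[cite: AharonovJonesLandau2009, §3.3, Claim 3.3 and Thm. 4.3] -/
theorem twoThirds_le_kernelProb (d : List Bool) : 2 / 3 ≤ family.kernelProb 0 d (Rcore d) := by
  classical
  set ℓ := d.length with hℓ
  have hker : family.kernelProb 0 d (Rcore d) =
      ∑ z : QReg (ℓ + anc ℓ), if List.ofFn z ∈ Rcore d then ‖(circ ℓ).runOn 0 (basisState (padInput d.get (anc ℓ))) z‖ ^ 2 else 0 := by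
    rw [QCircuitFamily.kernelProb, QCircuitFamily.kernel]
    exact toReal_outputPMF_map_ofFn (A := 0) (circ ℓ) d.get (Rcore d)
  rw [hker]
  -- the run: copies after fan-out
  have hrun : (circ ℓ).runOn 0 (basisState (padInput d.get (anc ℓ))) = (stage2 ℓ).toMatrix 0 *ᵥ basisState (z1 ℓ d.get) := by
    rw [QCircuit.runOn, circ_toMatrix, ← Matrix.mulVec_mulVec, stage1_mulVec]
  simp_rw [hrun]
  by_cases hW : WF ℓ d.get
  · -- well-formed input: the event is the good patterns
    have hfit := fits_of_pos hW.pos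
    have hmem : ∀ z : QReg (ℓ + anc ℓ), List.ofFn z ∈ Rcore d ↔ GoodPat ℓ hfit d.get (patternOf ℓ z) := by
      intro z
      show (∀ hW' : WF ℓ d.get, GoodPat ℓ (fits_of_pos hW'.pos) d.get fun j => (List.ofFn z).getD (Eblk ℓ j (Gb ℓ).q) false) ↔ _
      simp only [getD_ofFn]
      exact ⟨fun h' => h' hW, fun h' _ => h'⟩
    simp_rw [hmem]
    rw [← Finset.sum_filter]
    have hcp := copies_prob (Gb_ok ℓ) (blockDisjoint ℓ) (βOf ℓ hfit d.get) (ty ℓ) (x := z1 ℓ d.get) (fun j => z1_block_Pcopy hW j)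
      (fun j => z1_block_q d.get j) (p := patOf ℓ hfit d.get) (fun j => z1_block_E hfit d.get j) (Finset.univ.filter (GoodPat ℓ hfit d.get))
    have hA : (Finset.univ.filter fun z : QReg (ℓ + anc ℓ) => (fun j => z (Eblk ℓ j (Gb ℓ).q)) ∈ Finset.univ.filter (GoodPat ℓ hfit d.get)) =
        Finset.univ.filter fun z => GoodPat ℓ hfit d.get (patternOf ℓ z) := by
      ext z; simp only [Finset.mem_filter, Finset.mem_univ, true_and]; exact Iff.rfl
    rw [hA] at hcp
    change |(∑ z ∈ Finset.univ.filter (fun z => GoodPat ℓ hfit d.get (patternOf ℓ z)), ‖((stage2 ℓ).toMatrix 0 *ᵥ basisState (z1 ℓ d.get)) z‖ ^ 2) -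
      ∑ γ ∈ Finset.univ.filter (GoodPat ℓ hfit d.get), ∏ j, idealWeight (z₀ ℓ hfit d.get) (ty ℓ j) (γ j)| ≤ _ at hcp
    rw [idealSum_eq_pr] at hcp
    have hgood := AJLSampler.pr_good_ge_five_sixths (K := KOf ℓ) (norm_z₀_le ℓ hfit d.get) hW.pos (le_of_eq (by unfold KOf; ring))
    have herr := copies_err_le ℓ
    rw [abs_le] at hcp
    linarith [hcp.1]
  · -- ill-formed input: everything is accepted
    have hall : ∀ z : QReg (ℓ + anc ℓ), List.ofFn z ∈ Rcore d := fun z hW' => absurd hW' hW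
    simp only [hall, if_true]
    have h1 : ∑ z : QReg (ℓ + anc ℓ), ‖((stage2 ℓ).toMatrix 0 *ᵥ basisState (z1 ℓ d.get)) z‖ ^ 2 = 1 := by
      have := normSq_mulVec_of_mem_unitaryGroup (QCircuit.toMatrix_mem_unitaryGroup_holds cliffordT_isUnitary_holds 0 (stage2 ℓ)) (basisState (z1 ℓ d.get))
      rw [normSq_basisState] at this
      exact this
    rw [h1]; norm_num

end AJLCore

end Literature.Computability.QuantumComplexity

end
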